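import Summits.Ventures.DiscreteObjects.Hadamard.GSRowSumTypes167

/-!
# Hadamard 668 census — skew-type blocks in four-circulant quadruples of order 167: best matrices are EMPTY,
# good matrices are typed (kernel)

Framing: lottery ticket; floor = certified bounds/negative ranges.

Cell pub-namedobj (venture DiscreteObjects), target (H), hadamard gen 26.  A `±1` row `a` on `ZMod v` is of SKEW TYPE if
`a(-x) = -a(x)` for `x ≠ 0` (the circulant `A` satisfies `A + Aᵀ = 2a(0) I`); it is SYMMETRIC if `a(-x) = a(x)`.  The named
four-circulant families with skew-type blocks in the Goethals–Seidel array are: GOOD matrices (one skew-type + three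
symmetric blocks ⇒ a skew-Hadamard matrix of order `4v`), G-matrices (two + two), BEST matrices (three skew-type + one
symmetric ⇒ skew-Hadamard), and four skew-type blocks.  All are Goethals–Seidel quadruples (`GSQuad`: `Σ PAF = 0` off `0`),
so the row-sum grammar `(Σa)² + (Σb)² + (Σc)² + (Σd)² = 668` (`gs167_rowsums`) applies, and a skew-type row has row sum
`a(0) = ±1` (`rowsum_of_skewType`, any modulus).  Consequences at `v = 167` (kernel; symmetry of the other rows is NOT used):
* **`gsQuad167_no_three_skewType`** — three skew-type rows are impossible (`665` is not a square): **there are no best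
  matrices of order 167** (the known necessary condition `4v = d² + 3` for best matrices of order `v` fails at `v = 167`), and no quadruple with four
  skew-type rows (`gsQuad167_no_four_skewType`);
* `gsQuad167_two_skewType` — two skew-type rows force the other two absolute row sums to be `{15, 21}` (`666 = 15² + 21²` only);
* `gsQuad167_one_skewType` — one skew-type row (the GOOD-matrix shape, i.e. every Goethals–Seidel skew-Hadamard matrix of
  order 668 built from a skew-type block and three further circulants) forces the other three absolute row sums to be
  `{1, 15, 21}` or `{9, 15, 19}` (`667 = 1 + 15² + 21² = 9² + 15² + 19²` only).
STRUCTURE / NEGATIVE lines about hypothetical objects: one named sub-family (best matrices) is EMPTY at 167 by the grammar, the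
good-matrix family is typed; good matrices / skew-Hadamard matrices of order 668 remain OPEN; no Hadamard order excluded;
H(668) untouched; HITS 0/4.  Ours, elementary; no `sorry`; `decide` on the `13`-element list of odd naturals below `26`.
-/

open Finset BigOperators

namespace Summit.Ventures.DiscreteObjects.Hadamard

open Literature.Combinatorics.Designs.LegendrePairs (PAF IsPM)

/-! ## §1 Skew-type rows have row sum `a(0)` -/

/-- **a skew-type row has row sum `a(0)`**: the values at `x` and `-x` cancel (`x ≠ 0`); any modulus. -/
theorem rowsum_of_skewType {v : ℕ} [NeZero v] (a : ZMod v → ℤ) (hskew : ∀ x, x ≠ 0 → a (-x) = -a x) :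
    ∑ x, a x = a 0 := by
  have hneg : ∑ x, a (-x) = ∑ x, a x := Fintype.sum_equiv (Equiv.neg (ZMod v)) _ _ fun x => by simp
  have hsplit : ∀ f : ZMod v → ℤ, ∑ x, f x = f 0 + ∑ x ∈ univ.erase 0, f x := fun f =>
    (Finset.add_sum_erase _ f (mem_univ 0)).symm
  have h1 : ∑ x ∈ univ.erase (0 : ZMod v), a (-x) = -∑ x ∈ univ.erase (0 : ZMod v), a x := by
    rw [← Finset.sum_neg_distrib]
    exact Finset.sum_congr rfl fun x hx => hskew x (Finset.ne_of_mem_erase hx)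
  have e1 := hsplit (fun x => a (-x))
  simp only [neg_zero] at e1
  rw [hneg, h1] at e1
  have e2 := hsplit a
  linarith

/-- hence its squared row sum is `1` for a `±1` row. -/
lemma rowsum_sq_of_skewType {v : ℕ} [NeZero v] (a : ZMod v → ℤ) (ha : IsPM a) (hskew : ∀ x, x ≠ 0 → a (-x) = -a x) :
    (∑ x, a x) ^ 2 = 1 := by
  rw [rowsum_of_skewType a hskew]
  rcases ha 0 with h | h <;> rw [h] <;> norm_num

/-! ## §2 The tables (kernel) -/

/-- `665` is not the square of an odd natural below `26`. -/
lemma table_skew3 : ∀ z ∈ odds26, 1 + 1 + 1 + z ^ 2 ≠ 668 := by decide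

/-- `666 = y² + z²` with `y, z` odd below `26` only for `{y, z} = {15, 21}`. -/
lemma table_skew2 : ∀ y ∈ odds26, ∀ z ∈ odds26, 1 + 1 + y ^ 2 + z ^ 2 = 668 → (y = 15 ∧ z = 21) ∨ (y = 21 ∧ z = 15) := by
  decide

set_option maxRecDepth 100000 in
/-- `667 = x² + y² + z²` with `x, y, z` odd below `26` only for `{x, y, z} = {1, 15, 21}` or `{9, 15, 19}`. -/
lemma table_skew1 : ∀ x ∈ odds26, ∀ y ∈ odds26, ∀ z ∈ odds26, 1 + x ^ 2 + y ^ 2 + z ^ 2 = 668 →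
    ([x, y, z].insertionSort (· ≥ ·)) ∈ [[21, 15, 1], [19, 15, 9]] := by
  decide

/-! ## §3 The census lines at `v = 167` -/

section V167

variable {a b c d : ZMod 167 → ℤ}

/-- **no best matrices of order 167** (and more): a Goethals–Seidel quadruple over `ZMod 167` cannot have three skew-type rows
— the fourth squared row sum would be `668 - 3 = 665`, not a square. -/
theorem gsQuad167_no_three_skewType (hq : GSQuad a b c d) (ha : ∀ x, x ≠ 0 → a (-x) = -a x)
    (hb : ∀ x, x ≠ 0 → b (-x) = -b x) (hc : ∀ x, x ≠ 0 → c (-x) = -c x) : False := by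
  obtain ⟨hsq, -, -, -, hod⟩ := gs167_rowsums a b c d hq
  rw [rowsum_sq_of_skewType a hq.1 ha, rowsum_sq_of_skewType b hq.2.1 hb, rowsum_sq_of_skewType c hq.2.2.1 hc] at hsq
  refine table_skew3 _ (natAbs_mem_odds26 _ hod (by linarith)) ?_
  zify
  simp only [sq_abs]
  exact hsq

/-- in particular no quadruple with four skew-type rows. -/
theorem gsQuad167_no_four_skewType (hq : GSQuad a b c d) (ha : ∀ x, x ≠ 0 → a (-x) = -a x)
    (hb : ∀ x, x ≠ 0 → b (-x) = -b x) (hc : ∀ x, x ≠ 0 → c (-x) = -c x) : ¬ ∀ x, x ≠ 0 → d (-x) = -d x :=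
  fun _ => gsQuad167_no_three_skewType hq ha hb hc

/-- **two skew-type rows** (the G-matrix shape): the other two rows have absolute row sums `15` and `21`. -/
theorem gsQuad167_two_skewType (hq : GSQuad a b c d) (ha : ∀ x, x ≠ 0 → a (-x) = -a x)
    (hb : ∀ x, x ≠ 0 → b (-x) = -b x) :
    ((∑ x, c x).natAbs = 15 ∧ (∑ x, d x).natAbs = 21) ∨ ((∑ x, c x).natAbs = 21 ∧ (∑ x, d x).natAbs = 15) := by
  obtain ⟨hsq, -, -, hoc, hod⟩ := gs167_rowsums a b c d hq
  rw [rowsum_sq_of_skewType a hq.1 ha, rowsum_sq_of_skewType b hq.2.1 hb] at hsq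
  have pc := sq_nonneg (∑ x, c x); have pd := sq_nonneg (∑ x, d x)
  refine table_skew2 _ (natAbs_mem_odds26 _ hoc (by linarith)) _ (natAbs_mem_odds26 _ hod (by linarith)) ?_
  zify
  simp only [sq_abs]
  exact hsq

/-- **one skew-type row** (the good-matrix shape; the three other rows arbitrary `±1` circulant rows): the other three
absolute row sums are `{1, 15, 21}` or `{9, 15, 19}`. -/
theorem gsQuad167_one_skewType (hq : GSQuad a b c d) (ha : ∀ x, x ≠ 0 → a (-x) = -a x) :
    ([(∑ x, b x).natAbs, (∑ x, c x).natAbs, (∑ x, d x).natAbs].insertionSort (· ≥ ·)) ∈ [[21, 15, 1], [19, 15, 9]] := by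
  obtain ⟨hsq, -, hob, hoc, hod⟩ := gs167_rowsums a b c d hq
  rw [rowsum_sq_of_skewType a hq.1 ha] at hsq
  have pb := sq_nonneg (∑ x, b x); have pc := sq_nonneg (∑ x, c x); have pd := sq_nonneg (∑ x, d x)
  refine table_skew1 _ (natAbs_mem_odds26 _ hob (by linarith)) _ (natAbs_mem_odds26 _ hoc (by linarith))
    _ (natAbs_mem_odds26 _ hod (by linarith)) ?_
  zify
  simp only [sq_abs]
  exact hsq

/-- **summary (gen 26)**: skew-type blocks in four-circulant quadruples of order 167 — three or four: impossible (no best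
matrices of order 167); two: the symmetric-side sums are `{±15, ±21}`; one: `{1, 15, 21}` or `{9, 15, 19}` in absolute value.
lottery ticket; floor = certified bounds/negative ranges. -/
theorem gsQuad167_skewType_census (hq : GSQuad a b c d) (ha : ∀ x, x ≠ 0 → a (-x) = -a x) :
    ([(∑ x, b x).natAbs, (∑ x, c x).natAbs, (∑ x, d x).natAbs].insertionSort (· ≥ ·)) ∈ [[21, 15, 1], [19, 15, 9]] ∧
    ((∀ x, x ≠ 0 → b (-x) = -b x) →
      (((∑ x, c x).natAbs = 15 ∧ (∑ x, d x).natAbs = 21) ∨ ((∑ x, c x).natAbs = 21 ∧ (∑ x, d x).natAbs = 15)) ∧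
      ¬ ∀ x, x ≠ 0 → c (-x) = -c x) :=
  ⟨gsQuad167_one_skewType hq ha, fun hb => ⟨gsQuad167_two_skewType hq ha hb, fun hc => gsQuad167_no_three_skewType hq ha hb hc⟩⟩

end V167

end Summit.Ventures.DiscreteObjects.Hadamard
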